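import Summits.BirchSwinnertonDyer.Rank1Residual.Ordinary.PrimaryTorsionAlgebra
import Literature.NumberTheory.EllipticCurves.StrictSelmerRankOne
import HarnessLib

/-!
# The `p^∞` Kummer line of a Mordell–Weil generator and LOCAL TRIVIALITY = DIVISIBILITY UP TO TORSION
# (theorems only — no definition, no named fact; nothing asserted about any curve's BSD; C-16 stays a CONJECTURE)

HONEST FRAMING (cell `b2b-bsdres`, run/shared/lean/b2b/bsd-rank1-residual/, verbatim in every
file): the goal of the cell is to DELETE the COMBINATION-SHAPED residual classes of the
Birch–Swinnerton-Dyer formula for ALL analytic-rank `≤ 1` elliptic curves over `ℚ` — "full BSD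
formula for every rank `≤ 1` curve in class `C`" assembled STRICTLY from published theorems — so
that the rank-`≤ 1` remainder becomes exactly the CONSTRUCTION-SHAPED classes, which are TYPED
(missing-input `Prop`s), NOT attempted. This is not "finishing BSD". Seat `b2b-bsdres-additive-p3`
(X8 prover B / X7 joint; typer-designate for the cell conjecture C-16 = hyp C120.1 by hyp R-16 (e)).
This file books nothing and moves no mark; X7 / X8 stay CONSTRUCTION-SHAPED.

## What this file does

For an elliptic curve `W` over a number field `K`, a prime `p`, the tree's `p^∞` Kummer theory
(`Literature/NumberTheory/EllipticCurves/SelmerCorankProofs`: `kummerMapLevel`, `kummerPruferHom`,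
`kummerMapPInfty`, `range_kummerMapPInfty`) and a perfect `K`-field `E` (a completion) with the local
restriction `H¹(K, E[p^∞]) → H¹(E, E(K̄_E)[p^∞])` of `BSDSelmer` (`selmerLocalKerPrimaryTorsion`):
* `range_kummerPruferHom_eq_ker`, `kummerPruferHom_injective`: for `P₁` generating `E(K)` modulo torsion
  (and of infinite order) the Kummer line `ℚ_p/ℤ_p → H¹(K, E[p^∞])`, `[a/p^N] ↦ κ_N(a • P₁)`, is an
  isomorphism onto `im κ = ker (H¹(K,E[p^∞]) → H¹(K,E))`;
* `res_kummerMapLevel_eq_zero_of_eq_nsmul`, **`res_kummerMapLevel_eq_zero_iff`**: `κ_N(P)` restricts to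
  `0` in `H¹(E, E(K̄_E)[p^∞])` IFF the image of `P` lies in `p^N E(E) + E(E)_tors` (the tree's
  `StrictSelmerRankOne` had `⟹`; the converse is the coboundary of `ιQ − ιR` for the root `Q`).
Used by `Ordinary/StrictSelmerIndexRankOne.lean` (the strict-Selmer index in rank one, R1-DEPTH-LAW §2 (i)).

References: R. Greenberg, LNM 1716 (1999), §2 pp. 62–63 [Greenberg1999LNM]; J. H. Silverman, AEC 2nd ed.
(2009), VIII.§2, X.§4 [SilvermanAEC2009]; C. Skinner, Ann. of Math. 191 (2020), §2.2 [Skinner2020];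
`R1-DEPTH-LAW.md` §2 (i).
-/

noncomputable section

open scoped Classical
open scoped AddSubgroup

open WeierstrassCurve Literature.NumberTheory.EllipticCurves
  Literature.NumberTheory.GaloisRepresentations

universe u

namespace Summit.BirchSwinnertonDyer.Rank1Residual.Ordinary

/-! ### The `p^∞` Kummer line of a generator and its locally trivial part -/

section Kummer

variable {K : Type u} [Field K] [NumberField K] (W : WeierstrassCurve K) [W.IsElliptic]
variable (p : ℕ) [hp : Fact p.Prime] (hdiv : W.zsmul_geomPoints_surjective)


/-- **The Kummer line of a generator is the whole Kummer image.** If every point of `E(K)` is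
`a • P₁ + t` with `t` torsion, then the image of `ℚ_p/ℤ_p → H¹(K, E[p^∞])`, `[a/p^N] ↦ κ_N(a • P₁)`
(`kummerPruferHom`), is `ker (H¹(K, E[p^∞]) → H¹(K, E)) = im κ` (`range_kummerMapPInfty`; torsion points
have trivial Kummer classes). Greenberg 1999 §2 pp. 62–63. [folklore] -/
theorem range_kummerPruferHom_eq_ker {P₁ : W.toAffine.Point}
    (hgen : ∀ P : W.toAffine.Point, ∃ (a : ℤ) (t : W.toAffine.Point),
      IsOfFinAddOrder t ∧ P = a • P₁ + t) :
    (kummerPruferHom W p hdiv P₁).range = (primaryH1ToH1 W p).ker := by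
  ext c
  constructor
  · rintro ⟨x, rfl⟩
    obtain ⟨N, a, rfl⟩ := exists_eq_zsmul_prufGen p x
    rw [AddMonoidHom.mem_ker, map_zsmul, kummerPruferHom_prufGen, map_zsmul,
      primaryH1ToH1_kummerMapLevel]
    exact zsmul_zero a
  · intro hc
    have hc' : c ∈ (kummerMapPInfty W p hdiv).range := by rwa [range_kummerMapPInfty W p hdiv]
    obtain ⟨t, rfl⟩ := hc'
    obtain ⟨P, N, rfl⟩ := exists_eq_tmul_prufGen W p t
    obtain ⟨a, t', ht', rfl⟩ := hgen P
    refine ⟨a • prufGen p N, ?_⟩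
    rw [map_zsmul, kummerPruferHom_prufGen, kummerMapPInfty_tmul_prufGen, map_add,
      kummerMapLevel_eq_zero_of_isOfFinAddOrder W p hdiv N ht', add_zero, map_zsmul]

/-- **The Kummer line of a point of infinite order is a copy of `ℚ_p/ℤ_p`**: `[a/p^N] ↦ κ_N(a • P₁)` is
injective when `P₁` has infinite order and generates `E(K)` modulo torsion (if `κ_N(a • P₁) = 0` then
`p^k a • P₁ ∈ p^{N+k} E(K)`, so `p^N ∣ a`). Greenberg 1999 §2; `kummerMapPInfty_injective`. [folklore] -/
theorem kummerPruferHom_injective {P₁ : W.toAffine.Point} (hP₁ : ¬ IsOfFinAddOrder P₁)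
    (hgen : ∀ P : W.toAffine.Point, ∃ (a : ℤ) (t : W.toAffine.Point),
      IsOfFinAddOrder t ∧ P = a • P₁ + t) :
    Function.Injective (kummerPruferHom W p hdiv P₁) := by
  rw [injective_iff_map_eq_zero]
  intro x hx
  obtain ⟨N, a, rfl⟩ := exists_eq_zsmul_prufGen p x
  rw [map_zsmul, kummerPruferHom_prufGen, ← map_zsmul] at hx
  obtain ⟨k, P₀, hk⟩ := exists_of_kummerMapLevel_eq_zero W p hdiv N (a • P₁) hx
  obtain ⟨b, t, ht, rfl⟩ := hgen P₀
  -- `(p^k a - p^(N+k) b) • P₁` is torsion, hence the scalar vanishes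
  have htor : IsOfFinAddOrder ((((p ^ k : ℕ) : ℤ) * a - ((p ^ (N + k) : ℕ) : ℤ) * b) • P₁) := by
    have : (((p ^ k : ℕ) : ℤ) * a - ((p ^ (N + k) : ℕ) : ℤ) * b) • P₁ = p ^ (N + k) • t := by
      rw [sub_smul, mul_smul, mul_smul, natCast_zsmul, natCast_zsmul, hk, smul_add,
        add_sub_cancel_left]
    rw [this]
    exact ht.nsmul
  have hzero : ((p ^ k : ℕ) : ℤ) * a - ((p ^ (N + k) : ℕ) : ℤ) * b = 0 := by
    by_contra hne
    exact hP₁ (isOfFinAddOrder_of_zsmul hne htor)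
  rw [zsmul_prufGen_eq_zero_iff]
  refine ⟨b, ?_⟩
  have hpk : ((p ^ k : ℕ) : ℤ) ≠ 0 := Int.natCast_ne_zero.mpr (pow_ne_zero k hp.out.ne_zero)
  apply mul_left_cancel₀ hpk
  rw [sub_eq_zero] at hzero
  rw [hzero]
  push_cast
  ring

variable (E : Type u) [Field E] [Algebra K E] [PerfectField E]

omit [NumberField K] [W.IsElliptic] [PerfectField E] in
/-- Images of `E`-rational points in `E(K̄_E)` are fixed by `Γ_E`. [folklore] -/
theorem smul_map_toAlgHom_eq (τ : Field.absoluteGaloisGroup E) (R : (W.baseChange E).toAffine.Point) :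
    τ • (show localPoints W E from
        Affine.Point.map (W' := W) (IsScalarTower.toAlgHom K E (AlgebraicClosure E)) R) =
      (show localPoints W E from
        Affine.Point.map (W' := W) (IsScalarTower.toAlgHom K E (AlgebraicClosure E)) R) := by
  have hcomp : ((AlgEquiv.restrictScalars K
      (show AlgebraicClosure E ≃ₐ[E] AlgebraicClosure E from τ) :
        AlgebraicClosure E ≃ₐ[K] AlgebraicClosure E) :
        AlgebraicClosure E →ₐ[K] AlgebraicClosure E).comp
      (IsScalarTower.toAlgHom K E (AlgebraicClosure E)) =
        IsScalarTower.toAlgHom K E (AlgebraicClosure E) :=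
    AlgHom.ext fun x => (show AlgebraicClosure E ≃ₐ[E] AlgebraicClosure E from τ).commutes x
  rw [localPoints.smul_def]
  change Affine.Point.map _ (Affine.Point.map _ R) = Affine.Point.map _ R
  rw [Affine.Point.map_map, hcomp]

omit [NumberField K] [PerfectField E] in
/-- **Exact divisibility over `E` kills the local Kummer class.** If the image of `P ∈ E(K)` in `E(E)`
is `p^N • R` with `R ∈ E(E)`, then `κ_N(P)` restricts to `0` in `H¹(E, E(K̄_E)[p^∞])`: for the root
`Q` (`p^N Q = P`) the restricted cocycle `τ ↦ τ ιQ - ιQ` is the coboundary of the `p^N`-torsion point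
`ιQ - ιR`. Silverman AEC VIII.§2, X.§4; Greenberg 1999 §2. [folklore] -/
theorem res_kummerMapLevel_eq_zero_of_eq_nsmul (N : ℕ) (P : W.toAffine.Point)
    (R : (W.baseChange E).toAffine.Point)
    (h : Affine.Point.baseChange (W' := W) K E P = p ^ N • R) :
    resH1Hom (resGal (K := K) E) (primaryPointsMap W E p) (primaryPointsMap_smul W E p)
      (kummerMapLevel W p hdiv N P) = 0 := by
  have hQ : p ^ N • kummerRoot W p hdiv N P = toGeomPoints W P := nsmul_kummerRoot W p hdiv N P
  set Q := kummerRoot W p hdiv N P with hQdef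
  -- the image of `R` in `E(K̄_E)`, first in Mathlib's point type, then as a local point
  set jR₀ : (W.baseChange (AlgebraicClosure E)).toAffine.Point :=
    Affine.Point.map (W' := W) (IsScalarTower.toAlgHom K E (AlgebraicClosure E)) R with hjR₀
  have h1₀ : p ^ N • jR₀ =
      Affine.Point.map (W' := W) (IsScalarTower.toAlgHom K E (AlgebraicClosure E))
        (Affine.Point.baseChange (W' := W) K E P) := by
    rw [h, map_nsmul]
  have hjP : (show localPoints W E from
      Affine.Point.map (W' := W) (IsScalarTower.toAlgHom K E (AlgebraicClosure E))
        (Affine.Point.baseChange (W' := W) K E P)) = pointsMap W E (toGeomPoints W P) := by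
    change Affine.Point.map _ (Affine.Point.baseChange (W' := W) K E P) =
      Affine.Point.map (closureEmb (K := K) E)
        (Affine.Point.baseChange (W' := W) K (AlgebraicClosure K) P)
    rw [Affine.Point.map_baseChange, Affine.Point.map_baseChange]
  set jR : localPoints W E := (show localPoints W E from jR₀) with hjR
  have hfix : ∀ τ : Field.absoluteGaloisGroup E, τ • jR = jR := fun τ =>
    smul_map_toAlgHom_eq W E τ R
  have h1 : p ^ N • jR = pointsMap W E (toGeomPoints W P) := by
    rw [← hjP]
    exact h1₀
  have hD : p ^ N • (pointsMap W E Q - jR) = 0 := by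
    rw [smul_sub, ← map_nsmul, hQ, h1, sub_self]
  refine (map_oneCocycleClass _ (resGal (K := K) E)
    (resHomOfEquivariant (resGal (K := K) E) (primaryPointsMap W E p) (primaryPointsMap_smul W E p))
    (kummerCocycle W p N Q (smul_nsmul_of_nsmul_eq W p hQ))).trans ?_
  rw [oneCocycleClass_eq_zero_iff]
  refine ⟨⟨pointsMap W E Q - jR, (AddCommGroup.mem_primaryComponent).mpr ⟨N, hD⟩⟩,
    fun τ => Subtype.ext ?_⟩
  change pointsMap W E (resGal (K := K) E τ • Q - Q) =
    τ • (pointsMap W E Q - jR) - (pointsMap W E Q - jR)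
  rw [map_sub, pointsMap_smul, smul_sub, hfix]
  abel

omit [NumberField K] in
/-- **Local triviality of a Kummer class = divisibility up to torsion over `E`.** For `P ∈ E(K)`:
`κ_N(P)` restricts to `0` in `H¹(E, E(K̄_E)[p^∞])` iff the image of `P` in `E(E)` lies in
`p^N E(E) + E(E)_tors`. (`⟹`: tree `exists_eq_nsmul_add_of_res_kummerMapLevel_eq_zero`; `⟸`: split the
torsion part into its prime-to-`p` part, which is `p^N`-divisible, and its `p`-part of exponent `p^e`, then
apply `res_kummerMapLevel_eq_zero_of_eq_nsmul` to `p^e • P` at level `N + e`.) Silverman AEC VIII.§2, X.§4;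
Greenberg 1999 §2 pp. 62–63. [folklore] -/
theorem res_kummerMapLevel_eq_zero_iff (N : ℕ) (P : W.toAffine.Point) :
    resH1Hom (resGal (K := K) E) (primaryPointsMap W E p) (primaryPointsMap_smul W E p)
        (kummerMapLevel W p hdiv N P) = 0 ↔
      ∃ R T : (W.baseChange E).toAffine.Point, IsOfFinAddOrder T ∧
        Affine.Point.baseChange (W' := W) K E P = p ^ N • R + T := by
  constructor
  · exact exists_eq_nsmul_add_of_res_kummerMapLevel_eq_zero W p hdiv E N P
  · rintro ⟨R, T, hT, hPRT⟩
    -- split `T = u • T₁ + p^N • (w • T)` with `T₁` of `p`-power order `p^e`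
    have hn0 : addOrderOf T ≠ 0 := (addOrderOf_pos_iff.mpr hT).ne'
    obtain ⟨e, n', hn', hn⟩ := Nat.exists_eq_pow_mul_and_not_dvd hn0 p hp.out.ne_one
    have hT₁ : p ^ e • (n' • T) = 0 := by rw [smul_smul, ← hn, addOrderOf_nsmul_eq_zero]
    have hcop : IsCoprime (n' : ℤ) ((p ^ N : ℕ) : ℤ) := by
      rw [Int.isCoprime_iff_gcd_eq_one, Int.gcd_natCast_natCast]
      exact ((Nat.Prime.coprime_iff_not_dvd hp.out).mpr hn').symm.pow_right N
    obtain ⟨u, w, huw⟩ := hcop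
    have hTsplit : T = u • (n' • T) + p ^ N • (w • T) := by
      have h2 : T = (u * (n' : ℤ) + w * ((p ^ N : ℕ) : ℤ)) • T := by rw [huw, one_smul]
      conv_lhs => rw [h2]
      rw [add_smul, mul_smul, mul_smul, natCast_zsmul, natCast_zsmul, smul_comm w (p ^ N) T]
    -- `bc (p^e • P) = p^(N+e) • (R + w • T)` exactly
    let bc : W.toAffine.Point →+ (W.baseChange E).toAffine.Point :=
      Affine.Point.baseChange (W' := W) K E
    have hPRT' : bc P = p ^ N • R + T := hPRT
    have hexact : bc (p ^ e • P) = p ^ (N + e) • (R + w • T) := by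
      rw [map_nsmul, hPRT']
      conv_lhs => rw [hTsplit]
      rw [smul_add, smul_add, smul_comm (p ^ e) u (n' • T), hT₁, smul_zero, zero_add, pow_add,
        mul_comm, mul_smul, smul_add, smul_add]
    have h := res_kummerMapLevel_eq_zero_of_eq_nsmul W p hdiv E (N + e) (p ^ e • P) (R + w • T) hexact
    rwa [kummerMapLevel_level W p hdiv N e (N + e) rfl P] at h


end Kummer

end Summit.BirchSwinnertonDyer.Rank1Residual.Ordinary

end
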